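import Literature.NumberTheory.Rogawski1990.ArchChartOrbGBlockReductionSplit      -- ★ p850444∕p850462 (this seat): `integral_descConj_eq_smul_integral_descConj_of_block`; brings ★ D4b `chartOrbG_eq_integral_descended_of_cutoff`, ★ (A0-b)
import Literature.NumberTheory.Automorphic.ArchRankOneSplitOrbitContinuityParam    -- ★ p850511 (this seat) PARAM-JOINT: `continuous_integral_prod_conj_hypBlockGL_half_param`
import Literature.NumberTheory.Rogawski1990.ArchOrbFamGExtJumpSide                 -- ★ p850413 (LH3-p02 (g3)) §1: `archRG_insert_eq_absSub_mul_splitCofactor`, `continuous_splitCofactor`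
import Literature.NumberTheory.Rogawski1990.ArchHCOrbitalFamilyGExt                -- ★ (G′-EXT) LH3-p02 (g2): `orbFamGExt`, `orbFamGExt_apply`
import HarnessLib

/-!
# (I₂) AT THE REAL WALLS, ORDER 0, BINDER FORM: the ordinary orbital family `orbFamGExt ν′ a′ (S ∪ {w})` is CONTINUOUS across the real wall `x_w = 0`
# of a split chart — the (L-g) dress of ★ PARAM-JOINT (Harish-Chandra's `F_f^A` on the split Cartan of `U(1,1)`; Varadarajan 1989 §6.4 Thm 23;
# Rogawski 1990 §8.2 p. 119, §4.12; Shelstad 1979 §4 Lemma 4.3; Bouaziz 1994 §3.1 (I₂))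

Topic `NumberTheory/Rogawski1990`; namespace `Literature.NumberTheory.Rogawski1990`.  THEOREMS ONLY (no `def`, no instance, no notation, no axiom, no named fact, no `sorry`);
kernel lane `--kind proof --supports stmt-HodgeConjecture-24833`.  Cell `pub/hodgecm-mathlib`, crux H413 (`stmt-HodgeConjecture-24833`), F0∕P3c line LH3 (closer stub
`stub_N9`, N9″ DIRECT ROAD), letter L1 `HcOrbitalFamiliesStatement`, clause (I₂) «`orbFamGExt ν′ a′ S′` is `C^∞` on `InRegG s S′`» — part **(B) REAL WALLS `x_w = 0`, ORDER 0**
(LH3-plan (g3) RULING #10 2026-09-02T08:33:15Z → F0P3b-p01 (g15); part (A), the compact walls and everything off the real walls, is ★ p850547 `ArchInnerFormChartOrbitalSmoothWalls`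
(F0P3a-p05 (g20))).

THE MATHEMATICS.  On the split chart `S′ = S ∪ {w}` the normaliser splits off the real-root factor of the place `w`: `R′_{S′}(c) = |e^{x_w} − e^{−x_w}| · cof(c)` with `cof`
continuous (★ `archRG_insert_eq_absSub_mul_splitCofactor`, ★ `continuous_splitCofactor`).  At a point of the real wall `x_w = 0` the chart element `γ_c = gprimeTorus S′ c` is
singular: its centraliser `Z(s)` contains a rank-one block `B = U(1,1)`; after Harish-Chandra's descent to `Z(s)` (★ D4b `chartOrbG_eq_integral_descended_of_cutoff`: `chartOrbG S′ c =
C₀ · ∫_{Z(s)⧸T♯} (a′)_M(k γ_c k⁻¹)`, binder `hdesc`) and the block change of variables along `eM : Z(s) ≃ B × R`, `Ψ : Z(s)⧸T♯ ≃ₜ B⧸A` (★ `integral_descConj_eq_smul_integral_descConj_of_block`,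
binders `eM Ψ hΨ hmap` and the JOINT chart reading `hγ : eM γ_c = (hypBlockGL x_c ϑ(c), ρ(c))` for ALL `c ∈ U`), the normalised functional `|e^{x}−e^{−x}| · chartOrbG S′ c` IS, for
`x_c ≠ 0`, the cone chart `(C₀κ) · C • ∫_{K×N} (a′)_M(eM⁻¹(k · e^{iϑ(c)} a(x_c∕2) n a(x_c∕2) · k⁻¹, ρ(c))) d(κ_K ⊗ μ_N)` (★ (A0) `abs_sub_smul_integral_descConj_hypBlockGL_eq_smul_integral_prod`:
the Jacobian `|1 − e^{−2x}|` of `n ↦ a⁻¹ n a n⁻¹…` cancels `|eˣ − e⁻ˣ|` up to `eˣ`), and the cone chart has NO singularity at `x = 0`: it is jointly continuous in `c` on `U` by ★ PARAM-JOINT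
`continuous_integral_prod_conj_hypBlockGL_half_param` (parameter space `P := ↥U`, so only `ContinuousOn ϑ∕ρ U` is asked).  Hence `orbFamG S′ = cof · (cone chart)` on `U ∩ RegG S′`
with a right side continuous on `U`, and the `RegG`-extension `orbFamGExt S′` (★ `hcExtendG`: the `RegG`-limit where it exists) EQUALS that right side on `U ∩ InRegG s S′` — in
particular it is continuous there: clause (I₂) at order 0 across the real wall (and across any compact wall inside `U`, for free).

* §1 (group-free glue, any finite index `W`) **`hcExtendG_eqOn_of_continuousOn`** ∕ `continuousOn_hcExtendG_of_continuousOn`: a raw member agreeing on `U ∩ RegG S′` with a function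
  `H` continuous on the open `U` has extension `= H` on `U ∩ InRegG s S′`, hence continuous there.
* §2 (the joint block chart, binder form) `chartOrbG_eq_of_block_of_mem` (pointwise block reduction under the joint reading `hγ`),
  `absSub_mul_chartOrbG_eq_coneChart_of_block` (the identity off the wall), **`continuousOn_coneChart_of_block`** (PARAM-JOINT with `P := ↥U`),
  **`tendsto_absSub_mul_chartOrbG_nhdsWithin_realWall_of_block`** (the JOINT twin of the `hray` binder: `|e^{x_c}−e^{−x_c}| · chartOrbG S′ c ⟶ (C₀κ) · C • cone(e^{iϑ(p₀)})` as
  `c → p₀` within `{x_w ≠ 0}`, `p₀` on the wall; Rao's cone by ★ `integral_prod_conj_hypBlockGL_half_zero`).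
* §3 (the dress) `orbFamG_insert_eq_splitCofactor_mul`, **`continuousOn_orbFamGExt_realWall_of_block`** (HEAD: `ContinuousOn (orbFamGExt L α ν′ a′ (insert w S)) (U ∩ InRegG (slotSign L α)
  (insert w S))`), the value `orbFamGExt_eqOn_realWall_of_block`, the wall value `orbFamGExt_eq_cone_of_realWall_block`, and the D4b-instantiated
  **`continuousOn_orbFamGExt_realWall_descended_of_cutoff`** (`hdesc` discharged from the docking ∕ integrability binders `hCM` ∕ `hint` on `U ∩ {x_w ≠ 0}`).
HONEST SCOPE: ONE real wall at a time (at a corner `x_w = x_{w′} = 0` the centraliser has two rank-one blocks and `Ψ` is not instantiable — a product engine, not this file);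
ORDER 0 only (all orders = the same dress over an all-orders engine, (A0-smooth), with `|D_{w′}|` split off at every `w′ ∈ S′`); the binders `hdesc`∕`hCM`∕`hint` ((SPLIT-DOCK) at the
singular `s`) and `eM Ψ hΨ hmap hγ` ((M-UNFOLD) on the split chart + the frame bridge to `U(J)`, `J` antidiagonal) are discharged by their owners, as in ★ ED. 2.
HONEST LABEL: HC_CM is proved only modulo the 7 printed citations (2 remaining named inputs: hLiu418 = `stmt-HodgeConjecture-24832`, h413 = `stmt-HodgeConjecture-24833`) until rung 0
closes; count-neutral (a letter-L1 pay-down under binders; no stub closes by this file alone).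

## References
* [Varadarajan1989] V. S. Varadarajan, *An Introduction to Harmonic Analysis on Semisimple Lie Groups*, Cambridge Stud. Adv. Math. 16 (1989), §6.4 Lemma 21, Thm 23 (`F_f^A` is smooth on
  ALL of the split Cartan `A` of `SL(2, ℝ)`).
* [Rogawski1990] J. D. Rogawski, *Automorphic Representations of Unitary Groups in Three Variables*, Ann. of Math. Stud. 123 (1990), §4.12 Lemma 4.12.1 p. 66; §8.2 pp. 118–119.
* [Shelstad1979] D. Shelstad, *Characters and inner forms of a quasi-split group over ℝ*, Compositio Math. 39 (1979) 11–45, §4 p. 22, Lemma 4.3 (p. 25).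
* [Bouaziz1994IntegralesOrbitales] A. Bouaziz, *Intégrales orbitales sur les groupes de Lie réductifs*, Ann. Sci. ÉNS 27 (1994), §3.1 (I₂) p. 579; §6.2 p. 591.
* [Varadarajan1977] V. S. Varadarajan, *Harmonic Analysis on Real Reductive Groups*, LNM 576 (1977), Part I §1.12 (`'F_f` extends continuously across the real walls).
* [Folland1995] G. B. Folland, *A Course in Abstract Harmonic Analysis* (1995), §2.6 Thm. 2.49, (2.52).
-/

set_option autoImplicit false

noncomputable section

open MeasureTheory MeasureTheory.Measure Set Filter Topology NumberField NumberField.InfinitePlace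
open Literature.MeasureTheory.Group Literature.NumberTheory.Automorphic Literature.NumberTheory.Automorphic.UnitaryGroup Literature.NumberTheory.Automorphic.ArchCartan
open scoped MatrixGroups Matrix Pointwise NNReal Classical

namespace Literature.NumberTheory.Rogawski1990

/-! ## §1 Group-free glue: a raw member with a continuous model on an open set has a continuous extension there -/

section Glue

variable {W : Type*} [Fintype W] [DecidableEq W] (s : W → Fin 3 → SignType) (S' : Finset W) (g : (W → Fin 3 → ℝ) → ℂ)

omit [DecidableEq W] in
/-- **GLUE.**  If `H` is continuous on an open `U` and the raw member `g` agrees with `H` on `U ∩ RegG S′`, then the family member `hcExtendG s S′ g` (literally `g` on `RegG S′`, the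
`RegG`-limit on the walls of `InRegG s S′`) EQUALS `H` on `U ∩ InRegG s S′` (★ `hcExtendG_eq_of_tendsto`; ★ `RegG S′` is dense). [cite: Varadarajan1977, I §1.12]
[cite: Bouaziz1994IntegralesOrbitales, §3.1 (I₂) p. 579] -/
theorem hcExtendG_eqOn_of_continuousOn {U : Set (W → Fin 3 → ℝ)} (hU : IsOpen U) {H : (W → Fin 3 → ℝ) → ℂ} (hH : ContinuousOn H U)
    (hg : EqOn g H (U ∩ RegG S')) : EqOn (hcExtendG s S' g) H (U ∩ InRegG s S') := by
  intro c hc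
  by_cases hcr : c ∈ RegG S'
  · rw [hcExtendG_of_mem_regG s S' g hcr]
    exact hg ⟨hc.1, hcr⟩
  · refine hcExtendG_eq_of_tendsto s S' g hc.2 hcr ?_
    have h1 : Tendsto H (𝓝[RegG S'] c) (𝓝 (H c)) :=
      (hH.continuousAt (hU.mem_nhds hc.1)).tendsto.mono_left nhdsWithin_le_nhds
    refine h1.congr' ?_
    filter_upwards [self_mem_nhdsWithin, mem_nhdsWithin_of_mem_nhds (hU.mem_nhds hc.1)] with x hx hxU
    exact (hg ⟨hxU, hx⟩).symm

omit [DecidableEq W] in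
/-- **GLUE, continuity.**  Under the hypotheses of ★ `hcExtendG_eqOn_of_continuousOn`, `hcExtendG s S′ g` is continuous on `U ∩ InRegG s S′`. [cite: Varadarajan1977, I §1.12]
[cite: Bouaziz1994IntegralesOrbitales, §3.1 (I₂) p. 579] -/
theorem continuousOn_hcExtendG_of_continuousOn {U : Set (W → Fin 3 → ℝ)} (hU : IsOpen U) {H : (W → Fin 3 → ℝ) → ℂ} (hH : ContinuousOn H U)
    (hg : EqOn g H (U ∩ RegG S')) : ContinuousOn (hcExtendG s S' g) (U ∩ InRegG s S') :=
  (hH.mono inter_subset_left).congr (hcExtendG_eqOn_of_continuousOn s S' g hU hH hg)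

end Glue

/-! ## §2 The joint block chart near a real wall (binder form) -/

section JointChart

variable (L : Type) [Field L] [NumberField L] [IsCMField L] (α : Fin 3 → L)
  [MeasurableSpace ↥(arch (↥(maximalRealSubfield L)) L (IsCMField.complexConj L) 3 (Matrix.diagonal α))] [BorelSpace ↥(arch (↥(maximalRealSubfield L)) L (IsCMField.complexConj L) 3 (Matrix.diagonal α))]
  (ν' : Measure ↥(arch (↥(maximalRealSubfield L)) L (IsCMField.complexConj L) 3 (Matrix.diagonal α))) [ν'.IsHaarMeasure] [ν'.IsMulRightInvariant]
  (a' : ↥(arch (↥(maximalRealSubfield L)) L (IsCMField.complexConj L) 3 (Matrix.diagonal α)) → ℂ)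
  (S : Finset {w : InfinitePlace L // IsComplex w}) (w : {w : InfinitePlace L // IsComplex w})
  (s : ↥(arch (↥(maximalRealSubfield L)) L (IsCMField.complexConj L) 3 (Matrix.diagonal α)))
  (hT : chartTorusG L α (insert w S) ≤ Subgroup.centralizer ({s} : Set ↥(arch (↥(maximalRealSubfield L)) L (IsCMField.complexConj L) 3 (Matrix.diagonal α))))
  [MeasurableSpace (↥(Subgroup.centralizer ({s} : Set ↥(arch (↥(maximalRealSubfield L)) L (IsCMField.complexConj L) 3 (Matrix.diagonal α)))) ⧸ (chartTorusG L α (insert w S)).subgroupOf (Subgroup.centralizer ({s} : Set ↥(arch (↥(maximalRealSubfield L)) L (IsCMField.complexConj L) 3 (Matrix.diagonal α)))))]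
  [BorelSpace (↥(Subgroup.centralizer ({s} : Set ↥(arch (↥(maximalRealSubfield L)) L (IsCMField.complexConj L) 3 (Matrix.diagonal α)))) ⧸ (chartTorusG L α (insert w S)).subgroupOf (Subgroup.centralizer ({s} : Set ↥(arch (↥(maximalRealSubfield L)) L (IsCMField.complexConj L) 3 (Matrix.diagonal α)))))]
  -- the block: `U(Φ₂)(ℂ)` in the antidiagonal frame of ★ (A0-b), split torus `torusU`, compact `K`, unipotent `N`
  {J : Matrix (Fin 2) (Fin 2) ℂ} (hJ : J = (StdForm.antidiagonal 2).over ℂ)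
  [MeasurableSpace ↥(unitaryGroupOfForm (starRingEnd ℂ) J)] [BorelSpace ↥(unitaryGroupOfForm (starRingEnd ℂ) J)]
  {K : Subgroup ↥(unitaryGroupOfForm (starRingEnd ℂ) J)} (κK : Measure ↥K) (μN : Measure ↥(unipotentU (starRingEnd ℂ) J))
  [MeasurableSpace (↥(unitaryGroupOfForm (starRingEnd ℂ) J) ⧸ torusU (starRingEnd ℂ) J)] [BorelSpace (↥(unitaryGroupOfForm (starRingEnd ℂ) J) ⧸ torusU (starRingEnd ℂ) J)]
  (μ : Measure (↥(unitaryGroupOfForm (starRingEnd ℂ) J) ⧸ torusU (starRingEnd ℂ) J))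
  -- the block data and the JOINT chart reading on `U` ((M-UNFOLD) on the split chart discharges these by name)
  {R : Type*} [Group R] [TopologicalSpace R]
  (eM : ↥(Subgroup.centralizer ({s} : Set ↥(arch (↥(maximalRealSubfield L)) L (IsCMField.complexConj L) 3 (Matrix.diagonal α)))) ≃ₜ* ↥(unitaryGroupOfForm (starRingEnd ℂ) J) × R)
  (Ψ : (↥(Subgroup.centralizer ({s} : Set ↥(arch (↥(maximalRealSubfield L)) L (IsCMField.complexConj L) 3 (Matrix.diagonal α)))) ⧸ (chartTorusG L α (insert w S)).subgroupOf (Subgroup.centralizer ({s} : Set ↥(arch (↥(maximalRealSubfield L)) L (IsCMField.complexConj L) 3 (Matrix.diagonal α))))) ≃ₜ ↥(unitaryGroupOfForm (starRingEnd ℂ) J) ⧸ torusU (starRingEnd ℂ) J)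
  (hΨ : ∀ b : ↥(unitaryGroupOfForm (starRingEnd ℂ) J), Ψ.symm (QuotientGroup.mk b) = QuotientGroup.mk (eM.symm (b, 1)))
  {U : Set ({w : InfinitePlace L // IsComplex w} → Fin 3 → ℝ)} {ϑ : ({w : InfinitePlace L // IsComplex w} → Fin 3 → ℝ) → ℝ} {ρ : ({w : InfinitePlace L // IsComplex w} → Fin 3 → ℝ) → R}
  (hγ : ∀ c ∈ U, eM ⟨gprimeTorus L α (insert w S) c, hT (gprimeTorus_mem_chartTorusG L α (insert w S) c)⟩ =
    ((⟨hypBlockGL (c w 0) (ϑ c), hypBlockGL_mem_of_eq_over hJ (c w 0) (ϑ c)⟩ : ↥(unitaryGroupOfForm (starRingEnd ℂ) J)), ρ c))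

omit [MeasurableSpace ↥(unitaryGroupOfForm (starRingEnd ℂ) J)] [BorelSpace ↥(unitaryGroupOfForm (starRingEnd ℂ) J)] in
include hΨ hγ in
/-- **BLOCK REDUCTION UNDER THE JOINT READING** (pointwise in `c ∈ U`): if `chartOrbG L α ν′ (S ∪ {w}) a′ c = C₀ · ∫_{Z(s)⧸T♯} aM(k γ_c k⁻¹) dμZ` (`hdesc`, ★ D4b) and `Ψ_* μZ = κ • μ`,
`eM γ_c = (hypBlockGL x_c ϑ(c), ρ(c))`, then **`chartOrbG … c = (C₀κ) · ∫_{B⧸A} aM(eM⁻¹(y · hypBlockGL x_c ϑ(c) · y⁻¹, ρ(c))) dμ(ẏ)`** (★ `integral_descConj_eq_smul_integral_descConj_of_block`).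
[cite: Rogawski1990, §4.12 Lemma 4.12.1 p. 66; §8.2 p. 119] [cite: Folland1995, §2.6 (2.52)] -/
theorem chartOrbG_eq_of_block_of_mem
    (μZ : Measure (↥(Subgroup.centralizer ({s} : Set ↥(arch (↥(maximalRealSubfield L)) L (IsCMField.complexConj L) 3 (Matrix.diagonal α)))) ⧸ (chartTorusG L α (insert w S)).subgroupOf (Subgroup.centralizer ({s} : Set ↥(arch (↥(maximalRealSubfield L)) L (IsCMField.complexConj L) 3 (Matrix.diagonal α))))))
    {κ : ℝ≥0} (hmap : Measure.map Ψ μZ = κ • μ)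
    {aM : ↥(Subgroup.centralizer ({s} : Set ↥(arch (↥(maximalRealSubfield L)) L (IsCMField.complexConj L) 3 (Matrix.diagonal α)))) → ℂ} {C₀ : ℂ}
    {c : {w : InfinitePlace L // IsComplex w} → Fin 3 → ℝ} (hc : c ∈ U)
    (hdesc : chartOrbG L α ν' (insert w S) a' c =
      C₀ * ∫ kq, descConj (⟨gprimeTorus L α (insert w S) c, hT (gprimeTorus_mem_chartTorusG L α (insert w S) c)⟩ : ↥(Subgroup.centralizer ({s} : Set ↥(arch (↥(maximalRealSubfield L)) L (IsCMField.complexConj L) 3 (Matrix.diagonal α)))))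
          ((chartTorusG L α (insert w S)).subgroupOf (Subgroup.centralizer ({s} : Set ↥(arch (↥(maximalRealSubfield L)) L (IsCMField.complexConj L) 3 (Matrix.diagonal α)))))
          (fun t ht => Subtype.ext (forall_mem_chartTorusG_comm L α (insert w S) c (t : ↥(arch (↥(maximalRealSubfield L)) L (IsCMField.complexConj L) 3 (Matrix.diagonal α))) (Subgroup.mem_subgroupOf.1 ht)))
          aM kq ∂μZ) :
    chartOrbG L α ν' (insert w S) a' c =
      (C₀ * ((κ : ℝ) : ℂ)) * ∫ y, descConj ((⟨hypBlockGL (c w 0) (ϑ c), hypBlockGL_mem_of_eq_over hJ (c w 0) (ϑ c)⟩ : ↥(unitaryGroupOfForm (starRingEnd ℂ) J))) (torusU (starRingEnd ℂ) J)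
        (LineRing.forall_mem_torusU_comm (starRingEnd ℂ) J (hypBlockGL_mem_torusU hJ (c w 0) (ϑ c))) (fun b : ↥(unitaryGroupOfForm (starRingEnd ℂ) J) => aM (eM.symm (b, ρ c))) y ∂μ := by
  rw [hdesc, integral_descConj_eq_smul_integral_descConj_of_block _ (torusU (starRingEnd ℂ) J) eM Ψ hΨ μZ μ hmap _ _ (ρ c) (hγ c hc) _
    (LineRing.forall_mem_torusU_comm (starRingEnd ℂ) J (hypBlockGL_mem_torusU hJ (c w 0) (ϑ c))) aM, NNReal.smul_def, Complex.real_smul, mul_assoc]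

include hΨ hγ in
/-- **THE IDENTITY OFF THE WALL** (`x_c ≠ 0`, `c ∈ U`): with `μ = C • ((k,n) ↦ ⟦k n⟧)_*(κ_K ⊗ μ_N)` and `aM` continuous,
**`|e^{x_c} − e^{−x_c}| · chartOrbG … c = (C₀κ) · (C • ∫_{K×N} aM(eM⁻¹(k · (e^{iϑ(c)} · a(x_c∕2) n a(x_c∕2)) · k⁻¹, ρ(c))) d(κ_K ⊗ μ_N))`**, `a(y) = hypBlockGL y 0` — ★ (A0)
`abs_sub_smul_integral_descConj_hypBlockGL_eq_smul_integral_prod` after ★ `chartOrbG_eq_of_block_of_mem`. [cite: Varadarajan1989, §6.4 Lemma 21, Thm 23] [cite: Rogawski1990, §8.2 p. 119] -/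
theorem absSub_mul_chartOrbG_eq_coneChart_of_block [SFinite κK] [IsHaarMeasure μN] {C : ℝ≥0}
    (hμC : μ = C • Measure.map
      (fun q : ↥K × ↥(unipotentU (starRingEnd ℂ) J) =>
        (QuotientGroup.mk ((q.1 : ↥(unitaryGroupOfForm (starRingEnd ℂ) J)) * (q.2 : ↥(unitaryGroupOfForm (starRingEnd ℂ) J))) : ↥(unitaryGroupOfForm (starRingEnd ℂ) J) ⧸ torusU (starRingEnd ℂ) J))
      (κK.prod μN))
    (μZ : Measure (↥(Subgroup.centralizer ({s} : Set ↥(arch (↥(maximalRealSubfield L)) L (IsCMField.complexConj L) 3 (Matrix.diagonal α)))) ⧸ (chartTorusG L α (insert w S)).subgroupOf (Subgroup.centralizer ({s} : Set ↥(arch (↥(maximalRealSubfield L)) L (IsCMField.complexConj L) 3 (Matrix.diagonal α))))))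
    {κ : ℝ≥0} (hmap : Measure.map Ψ μZ = κ • μ)
    {aM : ↥(Subgroup.centralizer ({s} : Set ↥(arch (↥(maximalRealSubfield L)) L (IsCMField.complexConj L) 3 (Matrix.diagonal α)))) → ℂ} (haMc : Continuous aM) {C₀ : ℂ}
    {c : {w : InfinitePlace L // IsComplex w} → Fin 3 → ℝ} (hc : c ∈ U) (hx : c w 0 ≠ 0)
    (hdesc : chartOrbG L α ν' (insert w S) a' c =
      C₀ * ∫ kq, descConj (⟨gprimeTorus L α (insert w S) c, hT (gprimeTorus_mem_chartTorusG L α (insert w S) c)⟩ : ↥(Subgroup.centralizer ({s} : Set ↥(arch (↥(maximalRealSubfield L)) L (IsCMField.complexConj L) 3 (Matrix.diagonal α)))))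
          ((chartTorusG L α (insert w S)).subgroupOf (Subgroup.centralizer ({s} : Set ↥(arch (↥(maximalRealSubfield L)) L (IsCMField.complexConj L) 3 (Matrix.diagonal α)))))
          (fun t ht => Subtype.ext (forall_mem_chartTorusG_comm L α (insert w S) c (t : ↥(arch (↥(maximalRealSubfield L)) L (IsCMField.complexConj L) 3 (Matrix.diagonal α))) (Subgroup.mem_subgroupOf.1 ht)))
          aM kq ∂μZ) :
    ((|Real.exp (c w 0) - Real.exp (-c w 0)| : ℝ) : ℂ) * chartOrbG L α ν' (insert w S) a' c =
      (C₀ * ((κ : ℝ) : ℂ)) * ((C : ℝ) • ∫ q : ↥K × ↥(unipotentU (starRingEnd ℂ) J),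
        aM (eM.symm (((q.1 : ↥(unitaryGroupOfForm (starRingEnd ℂ) J)) *
          ((⟨hypBlockGL 0 (ϑ c), hypBlockGL_mem_of_eq_over hJ 0 (ϑ c)⟩ : ↥(unitaryGroupOfForm (starRingEnd ℂ) J)) *
            (⟨hypBlockGL (c w 0 / 2) 0, hypBlockGL_mem_of_eq_over hJ (c w 0 / 2) 0⟩ : ↥(unitaryGroupOfForm (starRingEnd ℂ) J)) *
            (q.2 : ↥(unitaryGroupOfForm (starRingEnd ℂ) J)) *
            (⟨hypBlockGL (c w 0 / 2) 0, hypBlockGL_mem_of_eq_over hJ (c w 0 / 2) 0⟩ : ↥(unitaryGroupOfForm (starRingEnd ℂ) J))) *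
          (q.1 : ↥(unitaryGroupOfForm (starRingEnd ℂ) J))⁻¹), ρ c)) ∂(κK.prod μN)) := by
  have hF : Continuous fun b : ↥(unitaryGroupOfForm (starRingEnd ℂ) J) => aM (eM.symm (b, ρ c)) :=
    haMc.comp (eM.symm.continuous.comp (continuous_id.prodMk continuous_const))
  rw [chartOrbG_eq_of_block_of_mem L α ν' a' S w s hT hJ μ eM Ψ hΨ hγ μZ hmap hc hdesc, mul_left_comm, ← Complex.real_smul,
    abs_sub_smul_integral_descConj_hypBlockGL_eq_smul_integral_prod hJ κK μN μ hμC _ hF (ϑ c) hx]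

omit [MeasurableSpace ↥(arch (↥(maximalRealSubfield L)) L (IsCMField.complexConj L) 3 (Matrix.diagonal α))] [BorelSpace ↥(arch (↥(maximalRealSubfield L)) L (IsCMField.complexConj L) 3 (Matrix.diagonal α))]
  [MeasurableSpace (↥(unitaryGroupOfForm (starRingEnd ℂ) J) ⧸ torusU (starRingEnd ℂ) J)] [BorelSpace (↥(unitaryGroupOfForm (starRingEnd ℂ) J) ⧸ torusU (starRingEnd ℂ) J)] hΨ hγ in
/-- **THE CONE CHART IS CONTINUOUS ON `U`** — no singularity at the real wall: for `U` open, `ϑ`, `ρ` continuous on `U`, `aM ∈ C_c(Z(s))`, `K` compact, `κ_K`, `μ_N` Haar,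
`c ↦ ∫_{K×N} aM(eM⁻¹(k · (e^{iϑ(c)} · a(x_c∕2) n a(x_c∕2)) · k⁻¹, ρ(c))) d(κ_K ⊗ μ_N)` is continuous on `U` — ★ PARAM-JOINT `continuous_integral_prod_conj_hypBlockGL_half_param` with the
parameter space `P := ↥U` (locally compact as an open subspace) and `F_u(b) = aM(eM⁻¹(b, ρ(u)))`, all supported in the compact `pr₁(eM(tsupport aM))`.
[cite: Varadarajan1989, §6.4 Thm 23] [cite: Rogawski1990, §8.2 p. 119] -/
theorem continuousOn_coneChart_of_block (hK : IsCompact (K : Set ↥(unitaryGroupOfForm (starRingEnd ℂ) J))) [IsHaarMeasure κK] [IsHaarMeasure μN]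
    (hU : IsOpen U) (hϑ : ContinuousOn ϑ U) (hρ : ContinuousOn ρ U)
    {aM : ↥(Subgroup.centralizer ({s} : Set ↥(arch (↥(maximalRealSubfield L)) L (IsCMField.complexConj L) 3 (Matrix.diagonal α)))) → ℂ} (haMc : Continuous aM) (haMs : HasCompactSupport aM) :
    ContinuousOn (fun c : {w : InfinitePlace L // IsComplex w} → Fin 3 → ℝ => ∫ q : ↥K × ↥(unipotentU (starRingEnd ℂ) J),
        aM (eM.symm (((q.1 : ↥(unitaryGroupOfForm (starRingEnd ℂ) J)) *
          ((⟨hypBlockGL 0 (ϑ c), hypBlockGL_mem_of_eq_over hJ 0 (ϑ c)⟩ : ↥(unitaryGroupOfForm (starRingEnd ℂ) J)) *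
            (⟨hypBlockGL (c w 0 / 2) 0, hypBlockGL_mem_of_eq_over hJ (c w 0 / 2) 0⟩ : ↥(unitaryGroupOfForm (starRingEnd ℂ) J)) *
            (q.2 : ↥(unitaryGroupOfForm (starRingEnd ℂ) J)) *
            (⟨hypBlockGL (c w 0 / 2) 0, hypBlockGL_mem_of_eq_over hJ (c w 0 / 2) 0⟩ : ↥(unitaryGroupOfForm (starRingEnd ℂ) J))) *
          (q.1 : ↥(unitaryGroupOfForm (starRingEnd ℂ) J))⁻¹), ρ c)) ∂(κK.prod μN)) U := by
  haveI : LocallyCompactSpace ↥U := hU.locallyCompactSpace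
  -- the parametrised block function `F_u(b) = aM(eM⁻¹(b, ρ u))`, `u ∈ U`
  have hρ' : Continuous fun u : ↥U => ρ (u : {w : InfinitePlace L // IsComplex w} → Fin 3 → ℝ) := hρ.comp_continuous continuous_subtype_val fun u => u.2
  have hϑ' : Continuous fun u : ↥U => ϑ (u : {w : InfinitePlace L // IsComplex w} → Fin 3 → ℝ) := hϑ.comp_continuous continuous_subtype_val fun u => u.2
  have hF : Continuous (Function.uncurry fun (u : ↥U) (b : ↥(unitaryGroupOfForm (starRingEnd ℂ) J)) => aM (eM.symm (b, ρ (u : {w : InfinitePlace L // IsComplex w} → Fin 3 → ℝ)))) :=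
    haMc.comp (eM.symm.continuous.comp (continuous_snd.prodMk (hρ'.comp continuous_fst)))
  have hS₀ : IsCompact (Prod.fst '' (eM '' tsupport aM)) := (haMs.isCompact.image eM.continuous).image continuous_fst
  have hFS : ∀ (u : ↥U) (g : ↥(unitaryGroupOfForm (starRingEnd ℂ) J)), g ∉ Prod.fst '' (eM '' tsupport aM) →
      aM (eM.symm (g, ρ (u : {w : InfinitePlace L // IsComplex w} → Fin 3 → ℝ))) = 0 := by
    intro u g hg
    by_contra h
    exact hg ⟨(g, ρ (u : {w : InfinitePlace L // IsComplex w} → Fin 3 → ℝ)), ⟨eM.symm (g, ρ (u : {w : InfinitePlace L // IsComplex w} → Fin 3 → ℝ)), subset_tsupport _ h, eM.apply_symm_apply _⟩, rfl⟩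
  have hcont := continuous_integral_prod_conj_hypBlockGL_half_param hJ κK μN hK
    (fun (u : ↥U) (b : ↥(unitaryGroupOfForm (starRingEnd ℂ) J)) => aM (eM.symm (b, ρ (u : {w : InfinitePlace L // IsComplex w} → Fin 3 → ℝ)))) hF hS₀ hFS
  have hΘ : Continuous fun u : ↥U => (u, (u : {w : InfinitePlace L // IsComplex w} → Fin 3 → ℝ) w 0, ϑ (u : {w : InfinitePlace L // IsComplex w} → Fin 3 → ℝ)) :=
    continuous_id.prodMk ((((continuous_apply 0).comp ((continuous_apply w).comp continuous_subtype_val))).prodMk hϑ')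
  rw [continuousOn_iff_continuous_restrict]
  refine (hcont.comp hΘ).congr fun u => ?_
  simp only [Function.comp_apply, Set.restrict_apply]

include hΨ hγ in
/-- **THE JOINT `x`-LIMIT AT A REAL-WALL POINT** (the joint twin of LH3-p02 (g3)'s `hray` binder): for `p₀ ∈ U` ON the wall (`x_{p₀} = 0`), under the binders of ★
`absSub_mul_chartOrbG_eq_coneChart_of_block` for every `c ∈ U` off the wall,
**`|e^{x_c} − e^{−x_c}| · chartOrbG L α ν′ (S ∪ {w}) a′ c ⟶ (C₀κ) · (C • ∫_{K×N} aM(eM⁻¹(e^{iϑ(p₀)} · k n k⁻¹, ρ(p₀))) d(κ_K ⊗ μ_N))`** as `c → p₀` within `{x_w ≠ 0}` — the cone chart is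
continuous at `p₀` (★ `continuousOn_coneChart_of_block`) and its value at `x = 0` is Rao's cone integral (★ `integral_prod_conj_hypBlockGL_half_zero`).
[cite: Varadarajan1989, §6.4 Thm 23] [cite: Shelstad1979, Lemma 4.3 (p. 25)] [cite: Rogawski1990, §8.2 p. 119] -/
theorem tendsto_absSub_mul_chartOrbG_nhdsWithin_realWall_of_block (hK : IsCompact (K : Set ↥(unitaryGroupOfForm (starRingEnd ℂ) J))) [IsHaarMeasure κK] [IsHaarMeasure μN] {C : ℝ≥0}
    (hμC : μ = C • Measure.map
      (fun q : ↥K × ↥(unipotentU (starRingEnd ℂ) J) =>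
        (QuotientGroup.mk ((q.1 : ↥(unitaryGroupOfForm (starRingEnd ℂ) J)) * (q.2 : ↥(unitaryGroupOfForm (starRingEnd ℂ) J))) : ↥(unitaryGroupOfForm (starRingEnd ℂ) J) ⧸ torusU (starRingEnd ℂ) J))
      (κK.prod μN))
    (hU : IsOpen U) (hϑ : ContinuousOn ϑ U) (hρ : ContinuousOn ρ U)
    (μZ : Measure (↥(Subgroup.centralizer ({s} : Set ↥(arch (↥(maximalRealSubfield L)) L (IsCMField.complexConj L) 3 (Matrix.diagonal α)))) ⧸ (chartTorusG L α (insert w S)).subgroupOf (Subgroup.centralizer ({s} : Set ↥(arch (↥(maximalRealSubfield L)) L (IsCMField.complexConj L) 3 (Matrix.diagonal α))))))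
    {κ : ℝ≥0} (hmap : Measure.map Ψ μZ = κ • μ)
    {aM : ↥(Subgroup.centralizer ({s} : Set ↥(arch (↥(maximalRealSubfield L)) L (IsCMField.complexConj L) 3 (Matrix.diagonal α)))) → ℂ} (haMc : Continuous aM) (haMs : HasCompactSupport aM) {C₀ : ℂ}
    (hdesc : ∀ c ∈ U, c w 0 ≠ 0 → chartOrbG L α ν' (insert w S) a' c =
      C₀ * ∫ kq, descConj (⟨gprimeTorus L α (insert w S) c, hT (gprimeTorus_mem_chartTorusG L α (insert w S) c)⟩ : ↥(Subgroup.centralizer ({s} : Set ↥(arch (↥(maximalRealSubfield L)) L (IsCMField.complexConj L) 3 (Matrix.diagonal α)))))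
          ((chartTorusG L α (insert w S)).subgroupOf (Subgroup.centralizer ({s} : Set ↥(arch (↥(maximalRealSubfield L)) L (IsCMField.complexConj L) 3 (Matrix.diagonal α)))))
          (fun t ht => Subtype.ext (forall_mem_chartTorusG_comm L α (insert w S) c (t : ↥(arch (↥(maximalRealSubfield L)) L (IsCMField.complexConj L) 3 (Matrix.diagonal α))) (Subgroup.mem_subgroupOf.1 ht)))
          aM kq ∂μZ)
    {p₀ : {w : InfinitePlace L // IsComplex w} → Fin 3 → ℝ} (hp₀ : p₀ ∈ U) (hx₀ : p₀ w 0 = 0) :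
    Tendsto (fun c : {w : InfinitePlace L // IsComplex w} → Fin 3 → ℝ => ((|Real.exp (c w 0) - Real.exp (-c w 0)| : ℝ) : ℂ) * chartOrbG L α ν' (insert w S) a' c)
      (𝓝[{c | c w 0 ≠ 0}] p₀)
      (𝓝 ((C₀ * ((κ : ℝ) : ℂ)) * ((C : ℝ) • ∫ q : ↥K × ↥(unipotentU (starRingEnd ℂ) J),
        aM (eM.symm (((⟨hypBlockGL 0 (ϑ p₀), hypBlockGL_mem_of_eq_over hJ 0 (ϑ p₀)⟩ : ↥(unitaryGroupOfForm (starRingEnd ℂ) J)) *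
          ((q.1 : ↥(unitaryGroupOfForm (starRingEnd ℂ) J)) * (q.2 : ↥(unitaryGroupOfForm (starRingEnd ℂ) J)) * (q.1 : ↥(unitaryGroupOfForm (starRingEnd ℂ) J))⁻¹)), ρ p₀)) ∂(κK.prod μN)))) := by
  haveI : CompactSpace ↥K := isCompact_iff_compactSpace.mp hK
  -- the cone chart is continuous at `p₀`; its value there is Rao's cone integral
  have hG := continuousOn_coneChart_of_block L α w s hJ κK μN eM hK hU hϑ hρ haMc haMs
  have hGp : Tendsto (fun c : {w : InfinitePlace L // IsComplex w} → Fin 3 → ℝ => (C₀ * ((κ : ℝ) : ℂ)) * ((C : ℝ) • ∫ q : ↥K × ↥(unipotentU (starRingEnd ℂ) J),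
        aM (eM.symm (((q.1 : ↥(unitaryGroupOfForm (starRingEnd ℂ) J)) *
          ((⟨hypBlockGL 0 (ϑ c), hypBlockGL_mem_of_eq_over hJ 0 (ϑ c)⟩ : ↥(unitaryGroupOfForm (starRingEnd ℂ) J)) *
            (⟨hypBlockGL (c w 0 / 2) 0, hypBlockGL_mem_of_eq_over hJ (c w 0 / 2) 0⟩ : ↥(unitaryGroupOfForm (starRingEnd ℂ) J)) *
            (q.2 : ↥(unitaryGroupOfForm (starRingEnd ℂ) J)) *
            (⟨hypBlockGL (c w 0 / 2) 0, hypBlockGL_mem_of_eq_over hJ (c w 0 / 2) 0⟩ : ↥(unitaryGroupOfForm (starRingEnd ℂ) J))) *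
          (q.1 : ↥(unitaryGroupOfForm (starRingEnd ℂ) J))⁻¹), ρ c)) ∂(κK.prod μN)))
      (𝓝[{c | c w 0 ≠ 0}] p₀) (𝓝 ((C₀ * ((κ : ℝ) : ℂ)) * ((C : ℝ) • ∫ q : ↥K × ↥(unipotentU (starRingEnd ℂ) J),
        aM (eM.symm (((q.1 : ↥(unitaryGroupOfForm (starRingEnd ℂ) J)) *
          ((⟨hypBlockGL 0 (ϑ p₀), hypBlockGL_mem_of_eq_over hJ 0 (ϑ p₀)⟩ : ↥(unitaryGroupOfForm (starRingEnd ℂ) J)) *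
            (⟨hypBlockGL (p₀ w 0 / 2) 0, hypBlockGL_mem_of_eq_over hJ (p₀ w 0 / 2) 0⟩ : ↥(unitaryGroupOfForm (starRingEnd ℂ) J)) *
            (q.2 : ↥(unitaryGroupOfForm (starRingEnd ℂ) J)) *
            (⟨hypBlockGL (p₀ w 0 / 2) 0, hypBlockGL_mem_of_eq_over hJ (p₀ w 0 / 2) 0⟩ : ↥(unitaryGroupOfForm (starRingEnd ℂ) J))) *
          (q.1 : ↥(unitaryGroupOfForm (starRingEnd ℂ) J))⁻¹), ρ p₀)) ∂(κK.prod μN)))) :=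
    (continuousAt_const.mul ((hG.continuousAt (hU.mem_nhds hp₀)).const_smul (C : ℝ))).tendsto.mono_left nhdsWithin_le_nhds
  rw [hx₀, integral_prod_conj_hypBlockGL_half_zero hJ κK μN (fun b : ↥(unitaryGroupOfForm (starRingEnd ℂ) J) => aM (eM.symm (b, ρ p₀))) (ϑ p₀)] at hGp
  refine hGp.congr' ?_
  filter_upwards [self_mem_nhdsWithin, mem_nhdsWithin_of_mem_nhds (hU.mem_nhds hp₀)] with c hc hcU
  exact (absSub_mul_chartOrbG_eq_coneChart_of_block L α ν' a' S w s hT hJ κK μN μ eM Ψ hΨ hγ hμC μZ hmap haMc hcU hc (hdesc c hcU hc)).symm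

/-! ## §3 The dress: (I₂) at order 0 across the real wall for `orbFamGExt ν′ a′ (S ∪ {w})` -/

omit hΨ hγ in
/-- **`orbFamG (S ∪ {w}) = cof · (|e^{x_w} − e^{−x_w}| · chartOrbG (S ∪ {w}))`** on an admissible label: the normaliser's real-root factor of the place `w` moved next to the chart
functional (★ `orbFamG_apply`, ★ `archRG_insert_eq_absSub_mul_splitCofactor`). [cite: Shelstad1979, §4 p. 22] [cite: Rogawski1990, §8.2 p. 118] -/
theorem orbFamG_insert_eq_splitCofactor_mul (hS' : ∀ w', w' ∈ insert w S → w' ∈ splitChartPlaces L α) (c : {w : InfinitePlace L // IsComplex w} → Fin 3 → ℝ) :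
    orbFamG L α ν' a' (insert w S) c =
      ((((‖Complex.exp (c w 0 + c w 2 * Complex.I) - Complex.exp (c w 1 * Complex.I)‖ * ‖Complex.exp (-c w 0 + c w 2 * Complex.I) - Complex.exp (c w 1 * Complex.I)‖ : ℝ) : ℂ) *
          ∏ w' ∈ Finset.univ.erase w,
            (if w' ∈ insert w S then
                ((|Real.exp (c w' 0) - Real.exp (-c w' 0)| *
                  ‖Complex.exp (c w' 0 + c w' 2 * Complex.I) - Complex.exp (c w' 1 * Complex.I)‖ * ‖Complex.exp (-c w' 0 + c w' 2 * Complex.I) - Complex.exp (c w' 1 * Complex.I)‖ : ℝ) : ℂ)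
              else (1 - (Circle.exp (c w' 1 - c w' 0) : ℂ)) * (1 - (Circle.exp (c w' 2 - c w' 0) : ℂ)) * (1 - (Circle.exp (c w' 2 - c w' 1) : ℂ))))) *
        ((((|Real.exp (c w 0) - Real.exp (-c w 0)| : ℝ) : ℂ)) * chartOrbG L α ν' (insert w S) a' c) := by
  rw [orbFamG_apply L α ν' a' hS' c, archRG_insert_eq_absSub_mul_splitCofactor S w c]
  ring

include hΨ hγ in
/-- **THE VALUE OF THE FAMILY ON `U ∩ InRegG`** (in particular ON the real wall): under the binders of ★ `continuousOn_orbFamGExt_realWall_of_block`,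
`orbFamGExt ν′ a′ (S ∪ {w}) c = cof(c) · (C₀κ) · (C • cone chart(c))` for every `c ∈ U ∩ InRegG s (S ∪ {w})` — on `U ∩ RegG` by ★ `absSub_mul_chartOrbG_eq_coneChart_of_block`, on the
walls as the `RegG`-limit of a function continuous on `U` (★ `hcExtendG_eqOn_of_continuousOn`). [cite: Varadarajan1977, I §1.12] [cite: Varadarajan1989, §6.4 Thm 23]
[cite: Bouaziz1994IntegralesOrbitales, §3.1 (I₂) p. 579] -/
theorem orbFamGExt_eqOn_realWall_of_block (hS' : ∀ w', w' ∈ insert w S → w' ∈ splitChartPlaces L α)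
    (hK : IsCompact (K : Set ↥(unitaryGroupOfForm (starRingEnd ℂ) J))) [IsHaarMeasure κK] [IsHaarMeasure μN] {C : ℝ≥0}
    (hμC : μ = C • Measure.map
      (fun q : ↥K × ↥(unipotentU (starRingEnd ℂ) J) =>
        (QuotientGroup.mk ((q.1 : ↥(unitaryGroupOfForm (starRingEnd ℂ) J)) * (q.2 : ↥(unitaryGroupOfForm (starRingEnd ℂ) J))) : ↥(unitaryGroupOfForm (starRingEnd ℂ) J) ⧸ torusU (starRingEnd ℂ) J))
      (κK.prod μN))
    (hU : IsOpen U) (hϑ : ContinuousOn ϑ U) (hρ : ContinuousOn ρ U)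
    (μZ : Measure (↥(Subgroup.centralizer ({s} : Set ↥(arch (↥(maximalRealSubfield L)) L (IsCMField.complexConj L) 3 (Matrix.diagonal α)))) ⧸ (chartTorusG L α (insert w S)).subgroupOf (Subgroup.centralizer ({s} : Set ↥(arch (↥(maximalRealSubfield L)) L (IsCMField.complexConj L) 3 (Matrix.diagonal α))))))
    {κ : ℝ≥0} (hmap : Measure.map Ψ μZ = κ • μ)
    {aM : ↥(Subgroup.centralizer ({s} : Set ↥(arch (↥(maximalRealSubfield L)) L (IsCMField.complexConj L) 3 (Matrix.diagonal α)))) → ℂ} (haMc : Continuous aM) (haMs : HasCompactSupport aM) {C₀ : ℂ}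
    (hdesc : ∀ c ∈ U, c w 0 ≠ 0 → chartOrbG L α ν' (insert w S) a' c =
      C₀ * ∫ kq, descConj (⟨gprimeTorus L α (insert w S) c, hT (gprimeTorus_mem_chartTorusG L α (insert w S) c)⟩ : ↥(Subgroup.centralizer ({s} : Set ↥(arch (↥(maximalRealSubfield L)) L (IsCMField.complexConj L) 3 (Matrix.diagonal α)))))
          ((chartTorusG L α (insert w S)).subgroupOf (Subgroup.centralizer ({s} : Set ↥(arch (↥(maximalRealSubfield L)) L (IsCMField.complexConj L) 3 (Matrix.diagonal α)))))
          (fun t ht => Subtype.ext (forall_mem_chartTorusG_comm L α (insert w S) c (t : ↥(arch (↥(maximalRealSubfield L)) L (IsCMField.complexConj L) 3 (Matrix.diagonal α))) (Subgroup.mem_subgroupOf.1 ht)))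
          aM kq ∂μZ) :
    EqOn (orbFamGExt L α ν' a' (insert w S))
      (fun c : {w : InfinitePlace L // IsComplex w} → Fin 3 → ℝ =>
        ((((‖Complex.exp (c w 0 + c w 2 * Complex.I) - Complex.exp (c w 1 * Complex.I)‖ * ‖Complex.exp (-c w 0 + c w 2 * Complex.I) - Complex.exp (c w 1 * Complex.I)‖ : ℝ) : ℂ) *
          ∏ w' ∈ Finset.univ.erase w,
            (if w' ∈ insert w S then
                ((|Real.exp (c w' 0) - Real.exp (-c w' 0)| *
                  ‖Complex.exp (c w' 0 + c w' 2 * Complex.I) - Complex.exp (c w' 1 * Complex.I)‖ * ‖Complex.exp (-c w' 0 + c w' 2 * Complex.I) - Complex.exp (c w' 1 * Complex.I)‖ : ℝ) : ℂ)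
              else (1 - (Circle.exp (c w' 1 - c w' 0) : ℂ)) * (1 - (Circle.exp (c w' 2 - c w' 0) : ℂ)) * (1 - (Circle.exp (c w' 2 - c w' 1) : ℂ))))) *
          ((C₀ * ((κ : ℝ) : ℂ)) * ((C : ℝ) • ∫ q : ↥K × ↥(unipotentU (starRingEnd ℂ) J),
            aM (eM.symm (((q.1 : ↥(unitaryGroupOfForm (starRingEnd ℂ) J)) *
              ((⟨hypBlockGL 0 (ϑ c), hypBlockGL_mem_of_eq_over hJ 0 (ϑ c)⟩ : ↥(unitaryGroupOfForm (starRingEnd ℂ) J)) *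
                (⟨hypBlockGL (c w 0 / 2) 0, hypBlockGL_mem_of_eq_over hJ (c w 0 / 2) 0⟩ : ↥(unitaryGroupOfForm (starRingEnd ℂ) J)) *
                (q.2 : ↥(unitaryGroupOfForm (starRingEnd ℂ) J)) *
                (⟨hypBlockGL (c w 0 / 2) 0, hypBlockGL_mem_of_eq_over hJ (c w 0 / 2) 0⟩ : ↥(unitaryGroupOfForm (starRingEnd ℂ) J))) *
              (q.1 : ↥(unitaryGroupOfForm (starRingEnd ℂ) J))⁻¹), ρ c)) ∂(κK.prod μN))))
      (U ∩ InRegG (slotSign L α) (insert w S)) := by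
  haveI : CompactSpace ↥K := isCompact_iff_compactSpace.mp hK
  have hG : ContinuousOn (fun c : {w : InfinitePlace L // IsComplex w} → Fin 3 → ℝ =>
        ((((‖Complex.exp (c w 0 + c w 2 * Complex.I) - Complex.exp (c w 1 * Complex.I)‖ * ‖Complex.exp (-c w 0 + c w 2 * Complex.I) - Complex.exp (c w 1 * Complex.I)‖ : ℝ) : ℂ) *
          ∏ w' ∈ Finset.univ.erase w,
            (if w' ∈ insert w S then
                ((|Real.exp (c w' 0) - Real.exp (-c w' 0)| *
                  ‖Complex.exp (c w' 0 + c w' 2 * Complex.I) - Complex.exp (c w' 1 * Complex.I)‖ * ‖Complex.exp (-c w' 0 + c w' 2 * Complex.I) - Complex.exp (c w' 1 * Complex.I)‖ : ℝ) : ℂ)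
              else (1 - (Circle.exp (c w' 1 - c w' 0) : ℂ)) * (1 - (Circle.exp (c w' 2 - c w' 0) : ℂ)) * (1 - (Circle.exp (c w' 2 - c w' 1) : ℂ))))) *
          ((C₀ * ((κ : ℝ) : ℂ)) * ((C : ℝ) • ∫ q : ↥K × ↥(unipotentU (starRingEnd ℂ) J),
            aM (eM.symm (((q.1 : ↥(unitaryGroupOfForm (starRingEnd ℂ) J)) *
              ((⟨hypBlockGL 0 (ϑ c), hypBlockGL_mem_of_eq_over hJ 0 (ϑ c)⟩ : ↥(unitaryGroupOfForm (starRingEnd ℂ) J)) *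
                (⟨hypBlockGL (c w 0 / 2) 0, hypBlockGL_mem_of_eq_over hJ (c w 0 / 2) 0⟩ : ↥(unitaryGroupOfForm (starRingEnd ℂ) J)) *
                (q.2 : ↥(unitaryGroupOfForm (starRingEnd ℂ) J)) *
                (⟨hypBlockGL (c w 0 / 2) 0, hypBlockGL_mem_of_eq_over hJ (c w 0 / 2) 0⟩ : ↥(unitaryGroupOfForm (starRingEnd ℂ) J))) *
              (q.1 : ↥(unitaryGroupOfForm (starRingEnd ℂ) J))⁻¹), ρ c)) ∂(κK.prod μN)))) U :=
    (continuous_splitCofactor S w).continuousOn.mul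
      (continuousOn_const.mul ((continuousOn_coneChart_of_block L α w s hJ κK μN eM hK hU hϑ hρ haMc haMs).const_smul (C : ℝ)))
  have heq : EqOn (orbFamG L α ν' a' (insert w S)) (fun c : {w : InfinitePlace L // IsComplex w} → Fin 3 → ℝ =>
        ((((‖Complex.exp (c w 0 + c w 2 * Complex.I) - Complex.exp (c w 1 * Complex.I)‖ * ‖Complex.exp (-c w 0 + c w 2 * Complex.I) - Complex.exp (c w 1 * Complex.I)‖ : ℝ) : ℂ) *
          ∏ w' ∈ Finset.univ.erase w,
            (if w' ∈ insert w S then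
                ((|Real.exp (c w' 0) - Real.exp (-c w' 0)| *
                  ‖Complex.exp (c w' 0 + c w' 2 * Complex.I) - Complex.exp (c w' 1 * Complex.I)‖ * ‖Complex.exp (-c w' 0 + c w' 2 * Complex.I) - Complex.exp (c w' 1 * Complex.I)‖ : ℝ) : ℂ)
              else (1 - (Circle.exp (c w' 1 - c w' 0) : ℂ)) * (1 - (Circle.exp (c w' 2 - c w' 0) : ℂ)) * (1 - (Circle.exp (c w' 2 - c w' 1) : ℂ))))) *
          ((C₀ * ((κ : ℝ) : ℂ)) * ((C : ℝ) • ∫ q : ↥K × ↥(unipotentU (starRingEnd ℂ) J),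
            aM (eM.symm (((q.1 : ↥(unitaryGroupOfForm (starRingEnd ℂ) J)) *
              ((⟨hypBlockGL 0 (ϑ c), hypBlockGL_mem_of_eq_over hJ 0 (ϑ c)⟩ : ↥(unitaryGroupOfForm (starRingEnd ℂ) J)) *
                (⟨hypBlockGL (c w 0 / 2) 0, hypBlockGL_mem_of_eq_over hJ (c w 0 / 2) 0⟩ : ↥(unitaryGroupOfForm (starRingEnd ℂ) J)) *
                (q.2 : ↥(unitaryGroupOfForm (starRingEnd ℂ) J)) *
                (⟨hypBlockGL (c w 0 / 2) 0, hypBlockGL_mem_of_eq_over hJ (c w 0 / 2) 0⟩ : ↥(unitaryGroupOfForm (starRingEnd ℂ) J))) *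
              (q.1 : ↥(unitaryGroupOfForm (starRingEnd ℂ) J))⁻¹), ρ c)) ∂(κK.prod μN)))) (U ∩ RegG (insert w S)) := by
    intro c hc
    have hx : c w 0 ≠ 0 := ((mem_regG_iff (insert w S) c).1 hc.2).2 w (Finset.mem_insert_self w S)
    dsimp only
    rw [orbFamG_insert_eq_splitCofactor_mul L α ν' a' S w hS' c,
      absSub_mul_chartOrbG_eq_coneChart_of_block L α ν' a' S w s hT hJ κK μN μ eM Ψ hΨ hγ hμC μZ hmap haMc hc.1 hx (hdesc c hc.1 hx)]
  rw [orbFamGExt_apply]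
  exact hcExtendG_eqOn_of_continuousOn (slotSign L α) (insert w S) _ hU hG heq

include hΨ hγ in
/-- **(I₂) AT ORDER 0 ACROSS THE REAL WALL `x_w = 0` — THE HEAD (binder form).**  On the split chart `S ∪ {w}` (admissible), let `U` be open, `s` centralise the chart torus
(`hT`), and assume: the descent identity `chartOrbG … c = C₀ · ∫_{Z(s)⧸T♯} aM(k γ_c k⁻¹) dμZ` for every `c ∈ U` OFF the wall (`hdesc`, ★ D4b; `aM ∈ C_c(Z(s))`), the block data
`eM : Z(s) ≃ B × R`, `Ψ : Z(s)⧸T♯ ≃ₜ B⧸A` with `Ψ⁻¹(bA) = eM⁻¹(b,1)T♯` and `Ψ_* μZ = κ • μ`, `μ = C • ((k,n) ↦ ⟦kn⟧)_*(κ_K ⊗ μ_N)` (`K` compact), and the JOINT chart reading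
`eM γ_c = (hypBlockGL x_c ϑ(c), ρ(c))` on `U` with `ϑ, ρ` continuous on `U`.  Then **`orbFamGExt L α ν′ a′ (S ∪ {w})` is continuous on `U ∩ InRegG (slotSign L α) (S ∪ {w})`** —
across the real wall `x_w = 0` (and across any compact wall inside `U`): Harish-Chandra's continuity of `'F_f` on the split Cartan, for the genuine family of `G′_∞`.
[cite: Varadarajan1989, §6.4 Thm 23] [cite: Varadarajan1977, I §1.12] [cite: Rogawski1990, §8.2 pp. 118–119] [cite: Shelstad1979, §4 Lemma 4.3 (p. 25)]
[cite: Bouaziz1994IntegralesOrbitales, §3.1 (I₂) p. 579] -/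
theorem continuousOn_orbFamGExt_realWall_of_block (hS' : ∀ w', w' ∈ insert w S → w' ∈ splitChartPlaces L α)
    (hK : IsCompact (K : Set ↥(unitaryGroupOfForm (starRingEnd ℂ) J))) [IsHaarMeasure κK] [IsHaarMeasure μN] {C : ℝ≥0}
    (hμC : μ = C • Measure.map
      (fun q : ↥K × ↥(unipotentU (starRingEnd ℂ) J) =>
        (QuotientGroup.mk ((q.1 : ↥(unitaryGroupOfForm (starRingEnd ℂ) J)) * (q.2 : ↥(unitaryGroupOfForm (starRingEnd ℂ) J))) : ↥(unitaryGroupOfForm (starRingEnd ℂ) J) ⧸ torusU (starRingEnd ℂ) J))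
      (κK.prod μN))
    (hU : IsOpen U) (hϑ : ContinuousOn ϑ U) (hρ : ContinuousOn ρ U)
    (μZ : Measure (↥(Subgroup.centralizer ({s} : Set ↥(arch (↥(maximalRealSubfield L)) L (IsCMField.complexConj L) 3 (Matrix.diagonal α)))) ⧸ (chartTorusG L α (insert w S)).subgroupOf (Subgroup.centralizer ({s} : Set ↥(arch (↥(maximalRealSubfield L)) L (IsCMField.complexConj L) 3 (Matrix.diagonal α))))))
    {κ : ℝ≥0} (hmap : Measure.map Ψ μZ = κ • μ)
    {aM : ↥(Subgroup.centralizer ({s} : Set ↥(arch (↥(maximalRealSubfield L)) L (IsCMField.complexConj L) 3 (Matrix.diagonal α)))) → ℂ} (haMc : Continuous aM) (haMs : HasCompactSupport aM) {C₀ : ℂ}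
    (hdesc : ∀ c ∈ U, c w 0 ≠ 0 → chartOrbG L α ν' (insert w S) a' c =
      C₀ * ∫ kq, descConj (⟨gprimeTorus L α (insert w S) c, hT (gprimeTorus_mem_chartTorusG L α (insert w S) c)⟩ : ↥(Subgroup.centralizer ({s} : Set ↥(arch (↥(maximalRealSubfield L)) L (IsCMField.complexConj L) 3 (Matrix.diagonal α)))))
          ((chartTorusG L α (insert w S)).subgroupOf (Subgroup.centralizer ({s} : Set ↥(arch (↥(maximalRealSubfield L)) L (IsCMField.complexConj L) 3 (Matrix.diagonal α)))))
          (fun t ht => Subtype.ext (forall_mem_chartTorusG_comm L α (insert w S) c (t : ↥(arch (↥(maximalRealSubfield L)) L (IsCMField.complexConj L) 3 (Matrix.diagonal α))) (Subgroup.mem_subgroupOf.1 ht)))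
          aM kq ∂μZ) :
    ContinuousOn (orbFamGExt L α ν' a' (insert w S)) (U ∩ InRegG (slotSign L α) (insert w S)) := by
  haveI : CompactSpace ↥K := isCompact_iff_compactSpace.mp hK
  have hG : ContinuousOn (fun c : {w : InfinitePlace L // IsComplex w} → Fin 3 → ℝ =>
        ((((‖Complex.exp (c w 0 + c w 2 * Complex.I) - Complex.exp (c w 1 * Complex.I)‖ * ‖Complex.exp (-c w 0 + c w 2 * Complex.I) - Complex.exp (c w 1 * Complex.I)‖ : ℝ) : ℂ) *
          ∏ w' ∈ Finset.univ.erase w,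
            (if w' ∈ insert w S then
                ((|Real.exp (c w' 0) - Real.exp (-c w' 0)| *
                  ‖Complex.exp (c w' 0 + c w' 2 * Complex.I) - Complex.exp (c w' 1 * Complex.I)‖ * ‖Complex.exp (-c w' 0 + c w' 2 * Complex.I) - Complex.exp (c w' 1 * Complex.I)‖ : ℝ) : ℂ)
              else (1 - (Circle.exp (c w' 1 - c w' 0) : ℂ)) * (1 - (Circle.exp (c w' 2 - c w' 0) : ℂ)) * (1 - (Circle.exp (c w' 2 - c w' 1) : ℂ))))) *
          ((C₀ * ((κ : ℝ) : ℂ)) * ((C : ℝ) • ∫ q : ↥K × ↥(unipotentU (starRingEnd ℂ) J),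
            aM (eM.symm (((q.1 : ↥(unitaryGroupOfForm (starRingEnd ℂ) J)) *
              ((⟨hypBlockGL 0 (ϑ c), hypBlockGL_mem_of_eq_over hJ 0 (ϑ c)⟩ : ↥(unitaryGroupOfForm (starRingEnd ℂ) J)) *
                (⟨hypBlockGL (c w 0 / 2) 0, hypBlockGL_mem_of_eq_over hJ (c w 0 / 2) 0⟩ : ↥(unitaryGroupOfForm (starRingEnd ℂ) J)) *
                (q.2 : ↥(unitaryGroupOfForm (starRingEnd ℂ) J)) *
                (⟨hypBlockGL (c w 0 / 2) 0, hypBlockGL_mem_of_eq_over hJ (c w 0 / 2) 0⟩ : ↥(unitaryGroupOfForm (starRingEnd ℂ) J))) *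
              (q.1 : ↥(unitaryGroupOfForm (starRingEnd ℂ) J))⁻¹), ρ c)) ∂(κK.prod μN)))) U :=
    (continuous_splitCofactor S w).continuousOn.mul
      (continuousOn_const.mul ((continuousOn_coneChart_of_block L α w s hJ κK μN eM hK hU hϑ hρ haMc haMs).const_smul (C : ℝ)))
  exact (hG.mono inter_subset_left).congr
    (orbFamGExt_eqOn_realWall_of_block L α ν' a' S w s hT hJ κK μN μ eM Ψ hΨ hγ hS' hK hμC hU hϑ hρ μZ hmap haMc haMs hdesc)

include hΨ hγ in
/-- **THE VALUE ON THE WALL ITSELF**: for `c ∈ U ∩ InRegG` with `x_c = 0`, `orbFamGExt ν′ a′ (S ∪ {w}) c = cof(c) · (C₀κ) · (C • ∫_{K×N} aM(eM⁻¹(e^{iϑ(c)} · k n k⁻¹, ρ(c))))` —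
Rao's cone integral at the central block element `e^{iϑ(c)}·1` (★ `integral_prod_conj_hypBlockGL_half_zero`): Harish-Chandra's value `'F_f` on the real wall.
[cite: Varadarajan1989, §6.4 Thm 23] [cite: Rogawski1990, §8.2 p. 119] [cite: Shelstad1979, Lemma 4.3 (p. 25)] -/
theorem orbFamGExt_eq_cone_of_realWall_block (hS' : ∀ w', w' ∈ insert w S → w' ∈ splitChartPlaces L α)
    (hK : IsCompact (K : Set ↥(unitaryGroupOfForm (starRingEnd ℂ) J))) [IsHaarMeasure κK] [IsHaarMeasure μN] {C : ℝ≥0}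
    (hμC : μ = C • Measure.map
      (fun q : ↥K × ↥(unipotentU (starRingEnd ℂ) J) =>
        (QuotientGroup.mk ((q.1 : ↥(unitaryGroupOfForm (starRingEnd ℂ) J)) * (q.2 : ↥(unitaryGroupOfForm (starRingEnd ℂ) J))) : ↥(unitaryGroupOfForm (starRingEnd ℂ) J) ⧸ torusU (starRingEnd ℂ) J))
      (κK.prod μN))
    (hU : IsOpen U) (hϑ : ContinuousOn ϑ U) (hρ : ContinuousOn ρ U)
    (μZ : Measure (↥(Subgroup.centralizer ({s} : Set ↥(arch (↥(maximalRealSubfield L)) L (IsCMField.complexConj L) 3 (Matrix.diagonal α)))) ⧸ (chartTorusG L α (insert w S)).subgroupOf (Subgroup.centralizer ({s} : Set ↥(arch (↥(maximalRealSubfield L)) L (IsCMField.complexConj L) 3 (Matrix.diagonal α))))))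
    {κ : ℝ≥0} (hmap : Measure.map Ψ μZ = κ • μ)
    {aM : ↥(Subgroup.centralizer ({s} : Set ↥(arch (↥(maximalRealSubfield L)) L (IsCMField.complexConj L) 3 (Matrix.diagonal α)))) → ℂ} (haMc : Continuous aM) (haMs : HasCompactSupport aM) {C₀ : ℂ}
    (hdesc : ∀ c ∈ U, c w 0 ≠ 0 → chartOrbG L α ν' (insert w S) a' c =
      C₀ * ∫ kq, descConj (⟨gprimeTorus L α (insert w S) c, hT (gprimeTorus_mem_chartTorusG L α (insert w S) c)⟩ : ↥(Subgroup.centralizer ({s} : Set ↥(arch (↥(maximalRealSubfield L)) L (IsCMField.complexConj L) 3 (Matrix.diagonal α)))))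
          ((chartTorusG L α (insert w S)).subgroupOf (Subgroup.centralizer ({s} : Set ↥(arch (↥(maximalRealSubfield L)) L (IsCMField.complexConj L) 3 (Matrix.diagonal α)))))
          (fun t ht => Subtype.ext (forall_mem_chartTorusG_comm L α (insert w S) c (t : ↥(arch (↥(maximalRealSubfield L)) L (IsCMField.complexConj L) 3 (Matrix.diagonal α))) (Subgroup.mem_subgroupOf.1 ht)))
          aM kq ∂μZ)
    {c : {w : InfinitePlace L // IsComplex w} → Fin 3 → ℝ} (hc : c ∈ U ∩ InRegG (slotSign L α) (insert w S)) (hx0 : c w 0 = 0) :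
    orbFamGExt L α ν' a' (insert w S) c =
      ((((‖Complex.exp (c w 0 + c w 2 * Complex.I) - Complex.exp (c w 1 * Complex.I)‖ * ‖Complex.exp (-c w 0 + c w 2 * Complex.I) - Complex.exp (c w 1 * Complex.I)‖ : ℝ) : ℂ) *
          ∏ w' ∈ Finset.univ.erase w,
            (if w' ∈ insert w S then
                ((|Real.exp (c w' 0) - Real.exp (-c w' 0)| *
                  ‖Complex.exp (c w' 0 + c w' 2 * Complex.I) - Complex.exp (c w' 1 * Complex.I)‖ * ‖Complex.exp (-c w' 0 + c w' 2 * Complex.I) - Complex.exp (c w' 1 * Complex.I)‖ : ℝ) : ℂ)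
              else (1 - (Circle.exp (c w' 1 - c w' 0) : ℂ)) * (1 - (Circle.exp (c w' 2 - c w' 0) : ℂ)) * (1 - (Circle.exp (c w' 2 - c w' 1) : ℂ))))) *
        ((C₀ * ((κ : ℝ) : ℂ)) * ((C : ℝ) • ∫ q : ↥K × ↥(unipotentU (starRingEnd ℂ) J),
            aM (eM.symm (((⟨hypBlockGL 0 (ϑ c), hypBlockGL_mem_of_eq_over hJ 0 (ϑ c)⟩ : ↥(unitaryGroupOfForm (starRingEnd ℂ) J)) *
              ((q.1 : ↥(unitaryGroupOfForm (starRingEnd ℂ) J)) * (q.2 : ↥(unitaryGroupOfForm (starRingEnd ℂ) J)) * (q.1 : ↥(unitaryGroupOfForm (starRingEnd ℂ) J))⁻¹)), ρ c)) ∂(κK.prod μN))) := by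
  refine (orbFamGExt_eqOn_realWall_of_block L α ν' a' S w s hT hJ κK μN μ eM Ψ hΨ hγ hS' hK hμC hU hϑ hρ μZ hmap haMc haMs hdesc hc).trans ?_
  dsimp only
  rw [show c w 0 / 2 = (0 : ℝ) / 2 by rw [hx0], integral_prod_conj_hypBlockGL_half_zero hJ κK μN (fun b : ↥(unitaryGroupOfForm (starRingEnd ℂ) J) => aM (eM.symm (b, ρ c))) (ϑ c)]

include hΨ hγ in
/-- **THE HEAD WITH ★ D4b's DESCENT INSTANTIATED** (`hdesc` discharged): with `νM` a right-∕inversion-invariant Haar measure on `Z(s)`, `a′ ∈ C_c(G′_∞)`, a cut-off `β ∈ C_c(G′_∞)`,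
`β ≥ 0`, of unit `Z(s)`-mass on `C″ · Z(s)`, and — for every `c ∈ U` OFF the wall — the docking `y′ γ_c y′⁻¹ ∈ tsupport a′ ⇒ y′ ∈ C″ · Z(s)` (`hCM`, (SPLIT-DOCK) at the singular `s`)
and the integrability of the chart integrand (`hint`, regular points), plus the block data over ★ D4b's quotient measure (`hmap`): `orbFamGExt L α ν′ a′ (S ∪ {w})` is continuous on
`U ∩ InRegG (slotSign L α) (S ∪ {w})` (★ `chartOrbG_eq_integral_descended_of_cutoff` ∘ ★ `continuousOn_orbFamGExt_realWall_of_block`; `(a′)_M^β ∈ C_c(Z(s))` by ★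
`continuous_integral_conj_subtype`, ★ `hasCompactSupport_integral_conj`). [cite: Rogawski1990, §4.12 Lemma 4.12.1 p. 66; §8.2 p. 119] [cite: HarishChandra1970, Part I §3 Lemmas 22–23]
[cite: Varadarajan1989, §6.4 Thm 23] [cite: Folland1995, §2.6 Thm. 2.49] -/
theorem continuousOn_orbFamGExt_realWall_descended_of_cutoff (hS' : ∀ w', w' ∈ insert w S → w' ∈ splitChartPlaces L α)
    (hK : IsCompact (K : Set ↥(unitaryGroupOfForm (starRingEnd ℂ) J))) [IsHaarMeasure κK] [IsHaarMeasure μN] {C : ℝ≥0}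
    (hμC : μ = C • Measure.map
      (fun q : ↥K × ↥(unipotentU (starRingEnd ℂ) J) =>
        (QuotientGroup.mk ((q.1 : ↥(unitaryGroupOfForm (starRingEnd ℂ) J)) * (q.2 : ↥(unitaryGroupOfForm (starRingEnd ℂ) J))) : ↥(unitaryGroupOfForm (starRingEnd ℂ) J) ⧸ torusU (starRingEnd ℂ) J))
      (κK.prod μN))
    (hU : IsOpen U) (hϑ : ContinuousOn ϑ U) (hρ : ContinuousOn ρ U)
    [LocallyCompactSpace ↥(Subgroup.centralizer ({s} : Set ↥(arch (↥(maximalRealSubfield L)) L (IsCMField.complexConj L) 3 (Matrix.diagonal α))))]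
    (νM : Measure ↥(Subgroup.centralizer ({s} : Set ↥(arch (↥(maximalRealSubfield L)) L (IsCMField.complexConj L) 3 (Matrix.diagonal α))))) [νM.IsHaarMeasure] [νM.IsMulRightInvariant] [νM.IsInvInvariant] (ha'c : Continuous a') (ha's : HasCompactSupport a')
    {C'' : Set ↥(arch (↥(maximalRealSubfield L)) L (IsCMField.complexConj L) 3 (Matrix.diagonal α))} {β : ↥(arch (↥(maximalRealSubfield L)) L (IsCMField.complexConj L) 3 (Matrix.diagonal α)) → ℝ} (hβc : Continuous β) (hβs : HasCompactSupport β) (hβ0 : ∀ g, 0 ≤ β g)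
    (hβ1 : ∀ x ∈ C'', ∀ k₀ : ↥(Subgroup.centralizer ({s} : Set ↥(arch (↥(maximalRealSubfield L)) L (IsCMField.complexConj L) 3 (Matrix.diagonal α)))), ∫ h : ↥(Subgroup.centralizer ({s} : Set ↥(arch (↥(maximalRealSubfield L)) L (IsCMField.complexConj L) 3 (Matrix.diagonal α)))), β (x * (k₀ : ↥(arch (↥(maximalRealSubfield L)) L (IsCMField.complexConj L) 3 (Matrix.diagonal α))) * (h : ↥(arch (↥(maximalRealSubfield L)) L (IsCMField.complexConj L) 3 (Matrix.diagonal α)))) ∂νM = 1)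
    (hCM : ∀ c ∈ U, c w 0 ≠ 0 → ∀ y' : ↥(arch (↥(maximalRealSubfield L)) L (IsCMField.complexConj L) 3 (Matrix.diagonal α)), y' * gprimeTorus L α (insert w S) c * y'⁻¹ ∈ tsupport a' → y' ∈ C'' * ((Subgroup.centralizer ({s} : Set ↥(arch (↥(maximalRealSubfield L)) L (IsCMField.complexConj L) 3 (Matrix.diagonal α)))) : Set ↥(arch (↥(maximalRealSubfield L)) L (IsCMField.complexConj L) 3 (Matrix.diagonal α))))
    (hint : ∀ c ∈ U, c w 0 ≠ 0 → Integrable (descConj (gprimeTorus L α (insert w S) c) (chartTorusG L α (insert w S)) (forall_mem_chartTorusG_comm L α (insert w S) c) a')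
      (chartQuotientMeasureG L α ν' (insert w S)))
    {κ : ℝ≥0}
    (hmap : (haveI := isHaarMeasure_chartHaarG L α (insert w S)
       haveI := isInvInvariant_chartHaarG L α (insert w S)
       haveI := isHaarMeasure_map_subgroupOfEquivOfLe_symm hT (chartHaarG L α (insert w S))
       haveI := isInvInvariant_map_subgroupOfEquivOfLe_symm hT (chartHaarG L α (insert w S))
      Measure.map Ψ (quotientMeasure ((chartTorusG L α (insert w S)).subgroupOf (Subgroup.centralizer ({s} : Set ↥(arch (↥(maximalRealSubfield L)) L (IsCMField.complexConj L) 3 (Matrix.diagonal α)))))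
          (Measure.map (Subgroup.subgroupOfEquivOfLe hT).symm (chartHaarG L α (insert w S)))
          (isClosed_subgroupOf_of_isClosed _ _ (isClosed_chartTorusG L α (insert w S))) νM)) = κ • μ) :
    ContinuousOn (orbFamGExt L α ν' a' (insert w S)) (U ∩ InRegG (slotSign L α) (insert w S)) := by
  haveI := isHaarMeasure_chartHaarG L α (insert w S)
  haveI := isInvInvariant_chartHaarG L α (insert w S)
  haveI := isHaarMeasure_map_subgroupOfEquivOfLe_symm hT (chartHaarG L α (insert w S))
  haveI := isInvInvariant_map_subgroupOfEquivOfLe_symm hT (chartHaarG L α (insert w S))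
  have hM' : IsClosed ((Subgroup.centralizer ({s} : Set ↥(arch (↥(maximalRealSubfield L)) L (IsCMField.complexConj L) 3 (Matrix.diagonal α)))) : Set ↥(arch (↥(maximalRealSubfield L)) L (IsCMField.complexConj L) 3 (Matrix.diagonal α))) := isClosed_centralizer_singleton_of_t2 s
  have haMc : Continuous fun m : ↥(Subgroup.centralizer ({s} : Set ↥(arch (↥(maximalRealSubfield L)) L (IsCMField.complexConj L) 3 (Matrix.diagonal α)))) => ∫ x', β x' • a' (x' * (m : ↥(arch (↥(maximalRealSubfield L)) L (IsCMField.complexConj L) 3 (Matrix.diagonal α))) * x'⁻¹) ∂ν' :=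
    continuous_integral_conj_subtype ν' _ hβc hβs ha'c
  have haMs : HasCompactSupport fun m : ↥(Subgroup.centralizer ({s} : Set ↥(arch (↥(maximalRealSubfield L)) L (IsCMField.complexConj L) 3 (Matrix.diagonal α)))) => ∫ x', β x' • a' (x' * (m : ↥(arch (↥(maximalRealSubfield L)) L (IsCMField.complexConj L) 3 (Matrix.diagonal α))) * x'⁻¹) ∂ν' :=
    hasCompactSupport_integral_conj ν' _ hM' hβs ha's
  exact continuousOn_orbFamGExt_realWall_of_block L α ν' a' S w s hT hJ κK μN μ eM Ψ hΨ hγ hS' hK hμC hU hϑ hρ _ hmap haMc haMs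
    fun c hc hx => chartOrbG_eq_integral_descended_of_cutoff L α ν' (insert w S) a' ha'c s νM hT hβc hβs hβ0 hβ1 c (hint c hc hx) (hCM c hc hx)

end JointChart

end Literature.NumberTheory.Rogawski1990

end

/-! ## §4 (ED. 2) Glue at ALL ORDERS — the `ContDiffOn` twin of §1 (for the (B∞) dress over ★ p850603 (A0-smooth); F0P3a-p05 (g20) «= want glue-∞» 2026-09-02T08:51:49Z) -/

namespace Literature.NumberTheory.Rogawski1990

open Literature.NumberTheory.Automorphic.ArchCartan

section GlueSmooth

variable {W : Type*} [Fintype W] (s : W → Fin 3 → SignType) (S' : Finset W) (g : (W → Fin 3 → ℝ) → ℂ)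

/-- **GLUE AT ALL ORDERS.**  If `H` is `C^n` on an open `U` and the raw member `g` agrees with `H` on `U ∩ RegG S′`, then the family member `hcExtendG s S′ g` is `C^n` on
`U ∩ InRegG s S′` (it EQUALS `H` there, ★ `hcExtendG_eqOn_of_continuousOn`; Mathlib `ContDiffOn.congr`).  Engine-agnostic: feed it the all-orders real-wall engine ★ p850603
(`contDiffOn_abs_sub_smul_integral_descConj_hypBlockGL_param`) dressed as in §3 to get clause (I₂) in full across the real walls. [cite: Varadarajan1977, I §1.12]
[cite: Bouaziz1994IntegralesOrbitales, §3.1 (I₂) p. 579] [cite: Varadarajan1989, §6.4 Thm 23] -/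
theorem contDiffOn_hcExtendG_of_contDiffOn {U : Set (W → Fin 3 → ℝ)} (hU : IsOpen U) {H : (W → Fin 3 → ℝ) → ℂ} {n : WithTop ℕ∞} (hH : ContDiffOn ℝ n H U)
    (hg : Set.EqOn g H (U ∩ RegG S')) : ContDiffOn ℝ n (hcExtendG s S' g) (U ∩ InRegG s S') :=
  (hH.mono Set.inter_subset_left).congr (hcExtendG_eqOn_of_continuousOn s S' g hU hH.continuousOn hg)

/-- **GLUE AT ALL ORDERS, on any subset**: under the same hypotheses `hcExtendG s S′ g` is `C^n` on every `V ⊆ U ∩ InRegG s S′` (e.g. `V = InRegG s S′ ∩ {c | c w 0 = 0}`-neighbourhoods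
patched over an atlas of `U`'s). [cite: Varadarajan1977, I §1.12] [cite: Bouaziz1994IntegralesOrbitales, §3.1 (I₂) p. 579] -/
theorem contDiffOn_hcExtendG_of_contDiffOn_of_subset {U : Set (W → Fin 3 → ℝ)} (hU : IsOpen U) {H : (W → Fin 3 → ℝ) → ℂ} {n : WithTop ℕ∞} (hH : ContDiffOn ℝ n H U)
    (hg : Set.EqOn g H (U ∩ RegG S')) {V : Set (W → Fin 3 → ℝ)} (hV : V ⊆ U ∩ InRegG s S') : ContDiffOn ℝ n (hcExtendG s S' g) V :=
  (contDiffOn_hcExtendG_of_contDiffOn s S' g hU hH hg).mono hV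

end GlueSmooth

end Literature.NumberTheory.Rogawski1990
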